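import Literature.MathematicalPhysics.QuantumFieldTheory.Balaban1983to89.B4Eq242TorusMirrors
import Literature.MathematicalPhysics.QuantumFieldTheory.Balaban1983to89.B6Prop22KLevelTorusCensusL0

/-!
# `Balaban1983to89.B6MultiLevelTorusMirrorL0` — [Balaban1984PropagatorsII] (2.1)–(2.2) p. 224 with p. 229 («an effective mass … up to +∞ outside Ω₁»):
# THE REFLECTED LEVEL-0 TORUS FAMILY — a `k′`-level family read on a grid-symmetric mirror box of its torus and REFLECTED across the box faces onto the doubled
# torus is again a family of the `…L0` lineage (same `L`, `M_h`, `R`; top level `k′`), to which p33's census `B6Prop22KLevelTorusCensusL0.prop22_supEntries_kLevelTorus`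
# applies BY NAME; its level function is invariant under the face reflections (the input of the signed method of images, [Balaban1983RegularityDecay] (2.42) p. 584)

statement-level skeleton of published theorems with citation tags; proofs where landed; nothing here is a claim about the Yang–Mills mass gap

CITATION HEADER (lean-in-tree rule).  [4] = T. Bałaban, *Propagators and renormalization transformations for lattice gauge theories. II*, Commun. Math. Phys. **96**
(1984) 223–250 [`Balaban1984PropagatorsII`], p. 224 (2.1) «Ω_j = B^j(Ω_j^{(j)}), Ω_j^{(j)} … is a sum of big blocks», (2.2) «(L^jη)^{−1}dist(Ω_j^c, Ω_{j+1}) > RM», p. 229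
«Boundary conditions of this type can be interpreted as obtained by building an effective mass on the domain Ω₁∖Ω_k, starting from O(1) on Ω_k up to +∞ outside Ω₁»;
[B4] = [`Balaban1983RegularityDecay`] (2.42) p. 584 (the multiple reflection method: the images of a box in the free lattice); [B9] = [`Balaban1985BackgroundPropagators`]
p. 394 («Δ′_a with Dirichlet boundary conditions on ∂Ω₀ … They depend on the configuration U restricted to Ω₀»), p. 408 (the cube sequence `{Ω_n(□)}`).

WHY THIS FILE (cell `pub-ymgap`, YM Track A D-0062, DAG node N06 = [B9], seat `pub-ymgap-dag-n06-c` g31; ROAD (I) «IMAGES» of LOCATED-31, file D2b).  The Dirichlet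
compression of a `…L0` torus operator to a mirror box `X` is, by the signed method of images (D1 `B4Eq242SignedImages`), read off the torus inverse of the SAME level
structure REFLECTED across the faces of `X` onto the doubled torus.  THIS FILE constructs that reflected family for an ARBITRARY `…L0` family `F` of top level `≤ k′` and
an arbitrary grid-aligned placement of the mirror box (no cube-specific geometry): new torus `Π_μ ℤ/N′_μ` with `N′_μ = 2m_μ·S_{k′}` in the mirrored directions
(`S_{k′} = M_h L^{k′+1}`, the lower mirror at the CENTRE `(S_{k′} − 1)/2` of the first top block, the upper one `m_μS_{k′}` further) and `N′_μ = N₀_μ` elsewhere; the level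
of a new site = the level of `F` at the old site under the folded, shifted embedding `y ↦ (fold y + g) mod N₀`.  (2.1) for the new family follows from the grid compatibility
of the fold (D2a: every `S_J`, `J ≤ k′`, has its mirrors at block centres since `L`, `M_h` are odd), (2.2) from the 1-Lipschitz property of the fold and `dist_{N′} ≥ dist_{N₀}`
on the closed box — WITHOUT any hypothesis on where the positive levels of `F` sit.

WHAT IS PROVED (definitions with bodies: `sTop`, `hMir`, `nMir`, `Pref`, `emb`, `levR`, `reflected` (the `TDomains`), `reflectedIdx` (its `KTIdx`); theorems; 0 sorry;
0 new named facts; standard axioms).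
* §1 THE MIRROR DATA OF A TOP LEVEL `k′`: `sTop = S_{k′}` (`sTop_odd`, `one_le_sTop`), `hMir = (S_{k′} − 1)/2` (`two_mul_hMir_add_one`), `nMir m μ = m_μ S_{k′}`, the new
  side vector `Pref` (`N0 ℓ Mh k′ Pref = 2 nMir` in the mirrored directions, `= N₀` in the others: `N0_Pref_of_mir`, `N0_Pref_of_not_mir`), the standing binder
  `hmir_of_top` of D2a, and ★ `hgrid_of_odd_factor` — EVERY odd factor `S` of `S_{k′}` sees the mirrors at `S`-block centres with `S ∣ n_μ` (`L`, `M_h` odd): the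
  big-block sides `S_J`, `J ≤ k′` (`hgrid_of_top`, the (2.1) input) and the block sides `L^j`, `j ≤ k′ + 1` (`hgrid_of_pow`, the grids of the averaging kernels).
* §2 THE EMBEDDING `emb g y = (y + g) mod N₀` of the new box into the old (`emb_mem`), block-preserving for every `S ∣ g`, `S ∣ N₀` (`blk_emb_eq_of_blk_eq`, via
  `ediv_eq_of_ediv_eq_of_dvd`: a finer common block forces a coarser common block), torus-distance preserving modulo `N₀` (`torusSupNorm_emb_sub`) and
  non-increasing from the new torus on the closed box (`torusSupNorm_emb_sub_le`).
* §3 ★★★ `reflected F …` : `B6MultiLevelTorusOperatorL0.TDomains d ℓ Mh k′ (Pref …) R` — the REFLECTED FAMILY (level `levR = F.lev ∘ emb ∘ fold` on the new box) with (2.1)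
  `bigBlocks` and (2.2) `sepT` PROVED; `levR_trefl` (the level function is invariant under every face reflection), `levR_of_mem_closed` (on the closed box it is `F`'s level at
  the embedded site), `reflected_lev`; ★ `reflectedIdx` : `KTIdx d ℓ` (`k′ ≥ 1`, `m_μ ≥ 2`, `P_μ ≥ 4`) — the census applies to it by name.

PROOF.  Ours (bookkeeping over D2a): §3 `bigBlocks` = `blk_tfold_eq_of_blk_eq` + `blk_emb_eq_of_blk_eq` + `F.bigBlocks`; `sepT` = `F.sepT` + `torusSupNorm_emb_sub_le` +
`torusSupNorm_tfold_sub_le`.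

HONEST SCOPE / NOT CLAIMED.  Geometry/bookkeeping only: no operator identity (that the reflected family's torus operator restricted to the box is the Dirichlet compression
of `F`'s is D3's row comparison), no estimate; the placement `g` and widths `m` are free parameters (the cube family's choice — `C₁(□)` inside the open box with a half-block
margin — is made in D3); nothing of [4]/[B4]/[B9] asserted.  Count-neutral; N06 NOT discharged; nothing on `d = 4`, the continuum, reflection positivity, the mass gap
or Clay.  No `sorry`, no `axiom`, no `instance`, no `notation`.  Seat `pub-ymgap-dag-n06-c` g31, 2026-08-31; `--supports stmt-QuantumFields-27239`.

RELATED IN THE TREE, NOT DUPLICATED (searched 2026-08-31, `rg` for `levR|reflectedIdx|MirrorL0|hgrid_of_top|hgrid_of_odd_factor` over `lean/Literature` + `lean/Summits`: 0 hits): p33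
`B6MultiLevelTorusOperatorL0.TDomains`/`B6Prop22KLevelTorusCensusL0.KTIdx` (the structures instantiated — used, not modified), r05 `B9CubeSequence408.cubeFam` and n05-c
`B8CubeMemberTorusDomainsL0.cubeTDomainsL0` (other `…L0` instances: a cube sequence, a cube member — other constructions, no reflection).
-/

namespace Literature.MathematicalPhysics.QuantumFieldTheory.Balaban1983to89.B6MultiLevelTorusMirrorL0

noncomputable section

open Finset
open Literature.MathematicalPhysics.QuantumFieldTheory.Balaban1983to89.B4Reflection242 (boxDom mem_boxDom blk)
open Literature.MathematicalPhysics.QuantumFieldTheory.Balaban1983to89.B4TorusKernel.MultiPeriod (circAbs torusSupNorm circAbs_nonneg circAbs_le_abs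
  circAbs_of_centred circAbs_add_mul)
open Literature.MathematicalPhysics.QuantumFieldTheory.Balaban1983to89.B6MultiLevelBoxOperator (N0 bigSide bigSide_succ one_le_bigSide)
open Literature.MathematicalPhysics.QuantumFieldTheory.Balaban1983to89.B6MultiLevelTorusOperator (twrap twrap_mem one_le_of_mem N0_eq_bigSide_mul one_le_N0)
open Literature.MathematicalPhysics.QuantumFieldTheory.Balaban1983to89.B6MultiLevelTorusOperatorL0 (TDomains)
open Literature.MathematicalPhysics.QuantumFieldTheory.Balaban1983to89.B6Prop22KLevelTorusCensusL0 (KTIdx)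
open Literature.MathematicalPhysics.QuantumFieldTheory.Balaban1983to89.B4Eq242TorusMirrors

variable {d : ℕ}

/-! ## §1  The mirror data of a top level `k′`: block-centre mirrors for every grid `S_J`, `J ≤ k′` -/

section Data

variable (ℓ Mh k k' : ℕ) (P : Fin (d + 1) → ℕ) (mir : Fin (d + 1) → Bool) (m : Fin (d + 1) → ℕ)

/-- the top big-block side `S_{k′} = M_h L^{k′+1}` as an integer. [cite: Balaban1984PropagatorsII, (2.1) p.224, dictionary] -/
def sTop : ℤ := (bigSide ℓ Mh k' : ℤ)

/-- the LOWER MIRROR coordinate: the centre `(S_{k′} − 1)/2` of the first top block of the new torus. [cite: Balaban1983RegularityDecay, (2.42) p.584; Balaban1984PropagatorsII, (2.1) p.224] -/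
def hMir : ℤ := (sTop ℓ Mh k' - 1) / 2

/-- the half-period `n_μ = m_μ S_{k′}` of the doubled torus in a mirrored direction (the upper mirror is `hMir + n_μ`). [cite: Balaban1983RegularityDecay, (2.42) p.584, dictionary] -/
def nMir (μ : Fin (d + 1)) : ℤ := (m μ : ℤ) * sTop ℓ Mh k'

/-- the side vector of the new torus in units of top blocks: `2m_μ` in the mirrored directions, `L^{k−k′}P_μ` in the others (so that `N0 ℓ Mh k′ Pref = N₀` there).
[cite: Balaban1984PropagatorsII, (2.1) p.224, dictionary] -/
def Pref (μ : Fin (d + 1)) : ℕ := if mir μ = true then 2 * m μ else (ℓ + 1) ^ (k - k') * P μ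

variable {ℓ Mh k k' P mir m}

/-- `S_{k′} = 2c + 1` is odd for odd `L`, `M_h`. [cite: Balaban1984PropagatorsII, (2.1) p.224, bookkeeping] -/
theorem sTop_odd (hL : Odd (ℓ + 1)) (hM : Odd Mh) : Odd (sTop ℓ Mh k') := by
  unfold sTop bigSide
  exact_mod_cast hM.mul (hL.pow)

/-- `S_{k′} ≥ 1`. [cite: Balaban1984PropagatorsII, (2.1) p.224, bookkeeping] -/
theorem one_le_sTop (hMh : 1 ≤ Mh) : 1 ≤ sTop ℓ Mh k' := by
  unfold sTop; exact_mod_cast one_le_bigSide hMh k'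

/-- `2·hMir + 1 = S_{k′}`. [cite: Balaban1984PropagatorsII, (2.1) p.224, bookkeeping] -/
theorem two_mul_hMir_add_one (hL : Odd (ℓ + 1)) (hM : Odd Mh) : 2 * hMir ℓ Mh k' + 1 = sTop ℓ Mh k' := by
  obtain ⟨c, hc⟩ := sTop_odd (k' := k') hL hM
  unfold hMir; rw [hc]; omega

/-- the new torus side in a mirrored direction is `2 n_μ`. [cite: Balaban1984PropagatorsII, (2.1) p.224, dictionary] -/
theorem N0_Pref_of_mir {μ : Fin (d + 1)} (hμ : mir μ = true) : (N0 ℓ Mh k' (Pref ℓ k k' P mir m) μ : ℤ) = 2 * nMir ℓ Mh k' m μ := by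
  rw [N0_eq_bigSide_mul]; unfold Pref nMir sTop; rw [if_pos hμ]; push_cast; ring

/-- the new torus side in a non-mirrored direction is the old one. [cite: Balaban1984PropagatorsII, (2.1) p.224, dictionary] -/
theorem N0_Pref_of_not_mir (hk : k' ≤ k) {μ : Fin (d + 1)} (hμ : ¬ mir μ = true) : N0 ℓ Mh k' (Pref ℓ k k' P mir m) μ = N0 ℓ Mh k P μ := by
  rw [N0_eq_bigSide_mul, N0_eq_bigSide_mul]; unfold Pref; rw [if_neg hμ]; unfold bigSide
  rw [← mul_assoc, show Mh * (ℓ + 1) ^ (k' + 1) * (ℓ + 1) ^ (k - k') = Mh * (ℓ + 1) ^ (k + 1) by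
    rw [mul_assoc, ← pow_add]; congr 2; omega]

/-- ★ THE STANDING MIRROR BINDER of D2a for this data: period `2n_μ`, `0 ≤ hMir < n_μ`, `n_μ ≥ 2` (`m_μ ≥ 2`). [cite: Balaban1983RegularityDecay, (2.42) p.584, bookkeeping] -/
theorem hmir_of_top (hL : Odd (ℓ + 1)) (hM : Odd Mh) (hMh : 1 ≤ Mh) (hm : ∀ μ, mir μ = true → 2 ≤ m μ) :
    ∀ μ, mir μ = true → (N0 ℓ Mh k' (Pref ℓ k k' P mir m) μ : ℤ) = 2 * nMir ℓ Mh k' m μ ∧ 0 ≤ hMir ℓ Mh k' ∧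
      hMir ℓ Mh k' < nMir ℓ Mh k' m μ ∧ 2 ≤ nMir ℓ Mh k' m μ := by
  intro μ hμ
  have h2 := two_mul_hMir_add_one (k' := k') hL hM
  have hS := one_le_sTop (ℓ := ℓ) (k' := k') hMh
  have hmμ : (2 : ℤ) ≤ m μ := by exact_mod_cast hm μ hμ
  refine ⟨N0_Pref_of_mir hμ, by omega, ?_, ?_⟩
  · unfold nMir; nlinarith
  · unfold nMir; nlinarith

/-- ★ THE GRID BINDER of D2a for EVERY ODD FACTOR `S` OF THE TOP SIDE (`S_{k′} = S·T`, `S`, `T` odd): the lower mirror is the centre of an `S`-block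
(`q₀ = (T − 1)/2`) and `S ∣ n_μ` (`n_S = m_μ T ≥ 1`) — covers the big-block sides `S_J` and the block sides `L^j`, `J, j ≤ k′`.
[cite: Balaban1984PropagatorsII, (2.1) p.224 («a sum of big blocks»); Balaban1983RegularityDecay, (2.42) p.584] -/
theorem hgrid_of_odd_factor (hm : ∀ μ, mir μ = true → 2 ≤ m μ) {S T : ℤ} (hS : Odd S) (hT : Odd T) (hfac : sTop ℓ Mh k' = S * T) (hT1 : 1 ≤ T) :
    ∀ μ, mir μ = true → ∃ c q₀ nS : ℤ, S = 2 * c + 1 ∧ hMir ℓ Mh k' = q₀ * S + c ∧ nMir ℓ Mh k' m μ = nS * S ∧ 1 ≤ nS := by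
  intro μ hμ
  obtain ⟨c, hc⟩ := hS
  obtain ⟨e, he⟩ := hT
  refine ⟨c, e, (m μ : ℤ) * T, hc, ?_, ?_, ?_⟩
  · unfold hMir; rw [hfac, hc, he]
    have : (2 * c + 1) * (2 * e + 1) - 1 = 2 * (e * (2 * c + 1) + c) := by ring
    rw [this, Int.mul_ediv_cancel_left _ two_ne_zero]
  · unfold nMir; rw [hfac]; ring
  · have h2 : (2 : ℤ) ≤ m μ := by exact_mod_cast hm μ hμ
    nlinarith

/-- the grid binder for the BIG-BLOCK sides `S_J`, `J ≤ k′` (`S_{k′} = S_J · L^{k′−J}`; odd `L`, `M_h`). [cite: Balaban1984PropagatorsII, (2.1) p.224; Balaban1983RegularityDecay, (2.42) p.584] -/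
theorem hgrid_of_top (hL : Odd (ℓ + 1)) (hM : Odd Mh) (hm : ∀ μ, mir μ = true → 2 ≤ m μ) {J : ℕ} (hJ : J ≤ k') :
    ∀ μ, mir μ = true → ∃ c q₀ nS : ℤ, ((bigSide ℓ Mh J : ℕ) : ℤ) = 2 * c + 1 ∧ hMir ℓ Mh k' = q₀ * (bigSide ℓ Mh J : ℕ) + c ∧
      nMir ℓ Mh k' m μ = nS * (bigSide ℓ Mh J : ℕ) ∧ 1 ≤ nS := by
  refine hgrid_of_odd_factor hm (T := (((ℓ + 1) ^ (k' - J) : ℕ) : ℤ)) (by unfold bigSide; exact_mod_cast hM.mul hL.pow)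
    (by exact_mod_cast hL.pow) ?_ (by exact_mod_cast Nat.one_le_pow _ _ (Nat.succ_pos ℓ))
  unfold sTop bigSide; push_cast
  rw [mul_assoc, ← pow_add]; congr 2; omega

/-- the grid binder for the BLOCK sides `L^j`, `j ≤ k′ + 1` (`S_{k′} = L^j · (M_h L^{k′+1−j})`; odd `L`, `M_h`) — the grids of the averaging kernels `Q′_j*Q′_j`.
[cite: Balaban1984PropagatorsII, (2.1) p.224, (2.14) p.225; Balaban1983RegularityDecay, (2.42) p.584] -/
theorem hgrid_of_pow (hL : Odd (ℓ + 1)) (hM : Odd Mh) (hMh : 1 ≤ Mh) (hm : ∀ μ, mir μ = true → 2 ≤ m μ) {j : ℕ} (hj : j ≤ k' + 1) :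
    ∀ μ, mir μ = true → ∃ c q₀ nS : ℤ, ((((ℓ + 1) ^ j : ℕ)) : ℤ) = 2 * c + 1 ∧ hMir ℓ Mh k' = q₀ * (((ℓ + 1) ^ j : ℕ) : ℤ) + c ∧
      nMir ℓ Mh k' m μ = nS * (((ℓ + 1) ^ j : ℕ) : ℤ) ∧ 1 ≤ nS := by
  refine hgrid_of_odd_factor hm (T := ((Mh * (ℓ + 1) ^ (k' + 1 - j) : ℕ) : ℤ)) (by exact_mod_cast hL.pow)
    (by exact_mod_cast hM.mul hL.pow) ?_
    (by exact_mod_cast Nat.one_le_iff_ne_zero.2 (Nat.mul_ne_zero_iff.2 ⟨by omega, Nat.pos_iff_ne_zero.1 (Nat.pow_pos (Nat.succ_pos ℓ))⟩))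
  unfold sTop bigSide; push_cast
  have e : (((ℓ : ℤ) + 1)) ^ (k' + 1) = ((ℓ : ℤ) + 1) ^ j * ((ℓ : ℤ) + 1) ^ (k' + 1 - j) := by rw [← pow_add]; congr 1; omega
  rw [e]; ring

end Data

/-! ## §2  The folded, shifted embedding of the new box into the old torus -/

section Emb

variable {ℓ Mh k : ℕ} {P : Fin (d + 1) → ℕ}

/-- a finer common block forces a coarser common block: `S ∣ T`, `⌊a/S⌋ = ⌊b/S⌋ ⇒ ⌊a/T⌋ = ⌊b/T⌋`. [cite: Balaban1984PropagatorsII, (2.1) p.224, bookkeeping] -/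
theorem ediv_eq_of_ediv_eq_of_dvd {S T a b : ℤ} (hS : 0 < S) (hST : S ∣ T) (he : a / S = b / S) : a / T = b / T := by
  obtain ⟨r, hr⟩ := hST
  rw [hr, ← Int.ediv_ediv_of_nonneg hS.le, ← Int.ediv_ediv_of_nonneg hS.le, he]

/-- **THE EMBEDDING** of a site of the new box into the old torus: shift by `g` and reduce modulo `N₀`. [cite: Balaban1984PropagatorsII, (2.1) p.224 (the torus `T_η`), dictionary] -/
def emb (g : Fin (d + 1) → ℤ) (y : Fin (d + 1) → ℤ) : Fin (d + 1) → ℤ := twrap (N0 ℓ Mh k P) (y + g)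

/-- the embedding lands in the old box. [cite: Balaban1984PropagatorsII, (2.1) p.224, bookkeeping] -/
theorem emb_mem (hMh : 1 ≤ Mh) (hP : ∀ μ, 1 ≤ P μ) (g y : Fin (d + 1) → ℤ) : emb (ℓ := ℓ) (Mh := Mh) (k := k) (P := P) g y ∈ boxDom (N0 ℓ Mh k P) :=
  twrap_mem (one_le_N0 hMh hP) _

/-- ★ THE EMBEDDING PRESERVES COMMON BLOCKS for every side `S` dividing the shift and the old torus sides. [cite: Balaban1984PropagatorsII, (2.1) p.224 («a sum of big blocks»), bookkeeping] -/
theorem blk_emb_eq_of_blk_eq (hMh : 1 ≤ Mh) (hP : ∀ μ, 1 ≤ P μ) {S : ℕ} (hS : 0 < S) {g : Fin (d + 1) → ℤ} (hg : ∀ μ, (S : ℤ) ∣ g μ)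
    (hSN : ∀ μ, (S : ℤ) ∣ (N0 ℓ Mh k P μ : ℤ)) {u u' : Fin (d + 1) → ℤ} (he : blk S u = blk S u') :
    blk S (emb (ℓ := ℓ) (Mh := Mh) (k := k) (P := P) g u) = blk S (emb (ℓ := ℓ) (Mh := Mh) (k := k) (P := P) g u') := by
  funext μ
  have hS' : (0 : ℤ) < S := by exact_mod_cast hS
  have heμ : u μ / (S : ℤ) = u' μ / (S : ℤ) := congrFun he μ
  obtain ⟨a, ha⟩ := hg μ
  obtain ⟨b, hb⟩ := hSN μ
  -- after the shift: same `S`-block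
  have h1 : (u μ + g μ) / (S : ℤ) = (u' μ + g μ) / (S : ℤ) := by
    rw [ha, show (S : ℤ) * a = a * S by ring, Int.add_mul_ediv_right _ _ hS'.ne', Int.add_mul_ediv_right _ _ hS'.ne', heμ]
  -- hence same `N₀`-block (`S ∣ N₀`), hence the same multiple of `N₀` is subtracted by the reduction
  have hN0 : (0 : ℤ) < N0 ℓ Mh k P μ := by exact_mod_cast one_le_N0 hMh hP μ
  have h2 : (u μ + g μ) / (N0 ℓ Mh k P μ : ℤ) = (u' μ + g μ) / (N0 ℓ Mh k P μ : ℤ) := ediv_eq_of_ediv_eq_of_dvd hS' (hSN μ) h1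
  show twrap (N0 ℓ Mh k P) (u + g) μ / (S : ℤ) = twrap (N0 ℓ Mh k P) (u' + g) μ / (S : ℤ)
  unfold twrap
  simp only [Pi.add_apply]
  rw [Int.emod_def, Int.emod_def, h2, hb]
  have e1 : u μ + g μ - (S : ℤ) * b * ((u' μ + g μ) / ((S : ℤ) * b)) = (u μ + g μ) + (-(b * ((u' μ + g μ) / ((S : ℤ) * b)))) * S := by ring
  have e2 : u' μ + g μ - (S : ℤ) * b * ((u' μ + g μ) / ((S : ℤ) * b)) = (u' μ + g μ) + (-(b * ((u' μ + g μ) / ((S : ℤ) * b)))) * S := by ring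
  rw [e1, e2, Int.add_mul_ediv_right _ _ hS'.ne', Int.add_mul_ediv_right _ _ hS'.ne', h1]

/-- the reduction modulo `N₀` does not change torus distances: `dist_{N₀}(emb u, emb u′) = dist_{N₀}(u − u′)`. [cite: Balaban1984PropagatorsII, (2.2) p.224 (torus distance), bookkeeping] -/
theorem torusSupNorm_emb_sub (g u u' : Fin (d + 1) → ℤ) :
    torusSupNorm (N0 ℓ Mh k P) (emb (ℓ := ℓ) (Mh := Mh) (k := k) (P := P) g u - emb (ℓ := ℓ) (Mh := Mh) (k := k) (P := P) g u') =
      torusSupNorm (N0 ℓ Mh k P) (u - u') := by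
  unfold torusSupNorm emb twrap
  congr 1; funext μ
  simp only [Pi.sub_apply, Pi.add_apply]
  rw [Int.emod_def, Int.emod_def]
  have e : u μ + g μ - (N0 ℓ Mh k P μ : ℤ) * ((u μ + g μ) / (N0 ℓ Mh k P μ : ℤ)) -
      (u' μ + g μ - (N0 ℓ Mh k P μ : ℤ) * ((u' μ + g μ) / (N0 ℓ Mh k P μ : ℤ))) =
      (u μ - u' μ) + (N0 ℓ Mh k P μ : ℤ) * ((u' μ + g μ) / (N0 ℓ Mh k P μ : ℤ) - (u μ + g μ) / (N0 ℓ Mh k P μ : ℤ)) := by ring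
  rw [e, circAbs_add_mul]

end Emb

/-! ## §3  The reflected family -/

section Reflected

variable {ℓ Mh k R : ℕ} {P : Fin (d + 1) → ℕ}

/-- the level function of the reflected family: `F`'s level at the folded, shifted, reduced site (and `0` off the new box). [cite: Balaban1984PropagatorsII, (2.1)–(2.4) p.224, p.229; Balaban1983RegularityDecay, (2.42) p.584] -/
def levR (F : TDomains d ℓ Mh k P R) (k' : ℕ) (mir : Fin (d + 1) → Bool) (m : Fin (d + 1) → ℕ) (g : Fin (d + 1) → ℤ)
    (hmir : ∀ μ, mir μ = true → (N0 ℓ Mh k' (Pref ℓ k k' P mir m) μ : ℤ) = 2 * nMir ℓ Mh k' m μ ∧ 0 ≤ hMir ℓ Mh k' ∧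
      hMir ℓ Mh k' < nMir ℓ Mh k' m μ ∧ 2 ≤ nMir ℓ Mh k' m μ)
    (y : Fin (d + 1) → ℤ) : ℕ :=
  if hy : y ∈ boxDom (N0 ℓ Mh k' (Pref ℓ k k' P mir m)) then
    F.lev (emb (ℓ := ℓ) (Mh := Mh) (k := k) (P := P) g
      (tfold (N := N0 ℓ Mh k' (Pref ℓ k k' P mir m)) (n := nMir ℓ Mh k' m) (h := fun _ => hMir ℓ Mh k') hmir ⟨y, hy⟩).1)
  else 0

variable {F : TDomains d ℓ Mh k P R} {k' : ℕ} {mir : Fin (d + 1) → Bool} {m : Fin (d + 1) → ℕ} {g : Fin (d + 1) → ℤ}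
  {hmir : ∀ μ, mir μ = true → (N0 ℓ Mh k' (Pref ℓ k k' P mir m) μ : ℤ) = 2 * nMir ℓ Mh k' m μ ∧ 0 ≤ hMir ℓ Mh k' ∧
      hMir ℓ Mh k' < nMir ℓ Mh k' m μ ∧ 2 ≤ nMir ℓ Mh k' m μ}

/-- on the new box the reflected level is `F`'s level at the embedded fold. [cite: Balaban1984PropagatorsII, (2.3)–(2.4) p.224, dictionary] -/
theorem levR_of_mem {y : Fin (d + 1) → ℤ} (hy : y ∈ boxDom (N0 ℓ Mh k' (Pref ℓ k k' P mir m))) :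
    levR F k' mir m g hmir y = F.lev (emb (ℓ := ℓ) (Mh := Mh) (k := k) (P := P) g
      (tfold (N := N0 ℓ Mh k' (Pref ℓ k k' P mir m)) (n := nMir ℓ Mh k' m) (h := fun _ => hMir ℓ Mh k') hmir ⟨y, hy⟩).1) := by
  unfold levR; rw [dif_pos hy]

/-- ★ THE REFLECTED LEVEL FUNCTION IS INVARIANT UNDER EVERY FACE REFLECTION (the reflected family is mirror-symmetric — the symmetry the method of images needs).
[cite: Balaban1983RegularityDecay, (2.42) p.584; Balaban1984PropagatorsII, (2.1) p.224] -/
theorem levR_trefl (ε : Fin (d + 1) → Bool) (y : ↥(boxDom (N0 ℓ Mh k' (Pref ℓ k k' P mir m)))) :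
    levR F k' mir m g hmir (trefl (n := nMir ℓ Mh k' m) (h := fun _ => hMir ℓ Mh k') hmir ε y).1 = levR F k' mir m g hmir y.1 := by
  rw [levR_of_mem (trefl hmir ε y).2, levR_of_mem y.2]
  have : (⟨(trefl (n := nMir ℓ Mh k' m) (h := fun _ => hMir ℓ Mh k') hmir ε y).1, (trefl hmir ε y).2⟩ :
      ↥(boxDom (N0 ℓ Mh k' (Pref ℓ k k' P mir m)))) = trefl hmir ε y := rfl
  rw [this, tfold_trefl]

/-- on the CLOSED mirror box the reflected level is `F`'s level at the embedded site itself. [cite: Balaban1984PropagatorsII, (2.3)–(2.4) p.224, dictionary] -/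
theorem levR_of_mem_closed {y : ↥(boxDom (N0 ℓ Mh k' (Pref ℓ k k' P mir m)))}
    (hy : y ∈ mirBoxClosed (N0 ℓ Mh k' (Pref ℓ k k' P mir m)) mir (nMir ℓ Mh k' m) (fun _ => hMir ℓ Mh k')) :
    levR F k' mir m g hmir y.1 = F.lev (emb (ℓ := ℓ) (Mh := Mh) (k := k) (P := P) g y.1) := by
  rw [levR_of_mem y.2]
  have : (⟨y.1, y.2⟩ : ↥(boxDom (N0 ℓ Mh k' (Pref ℓ k k' P mir m)))) = y := rfl
  rw [this, tfold_of_mem_closed hmir hy]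

/-- the torus distance of the old torus between embedded points of the CLOSED box is at most the new torus distance (in a mirrored direction both live in a window of
width `n_μ = N′_μ/2`, where the new circular distance is the plain one). [cite: Balaban1984PropagatorsII, (2.2) p.224 (torus distance), bookkeeping] -/
theorem torusSupNorm_emb_sub_le (hMh : 1 ≤ Mh) (hP : ∀ μ, 1 ≤ P μ) (hk : k' ≤ k)
    {u u' : ↥(boxDom (N0 ℓ Mh k' (Pref ℓ k k' P mir m)))}
    (hu : u ∈ mirBoxClosed (N0 ℓ Mh k' (Pref ℓ k k' P mir m)) mir (nMir ℓ Mh k' m) (fun _ => hMir ℓ Mh k'))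
    (hu' : u' ∈ mirBoxClosed (N0 ℓ Mh k' (Pref ℓ k k' P mir m)) mir (nMir ℓ Mh k' m) (fun _ => hMir ℓ Mh k')) :
    torusSupNorm (N0 ℓ Mh k P) (emb (ℓ := ℓ) (Mh := Mh) (k := k) (P := P) g u.1 - emb (ℓ := ℓ) (Mh := Mh) (k := k) (P := P) g u'.1) ≤
      torusSupNorm (N0 ℓ Mh k' (Pref ℓ k k' P mir m)) (u.1 - u'.1) := by
  rw [torusSupNorm_emb_sub]
  unfold torusSupNorm
  refine Finset.sup'_le _ _ fun μ _ => le_trans ?_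
    (Finset.le_sup' (fun i => ((circAbs (N0 ℓ Mh k' (Pref ℓ k k' P mir m) i) ((u.1 - u'.1) i) : ℤ) : ℝ)) (Finset.mem_univ μ))
  rw [mirBoxClosed, Finset.mem_filter] at hu hu'
  by_cases hm : mir μ = true
  · -- mirrored direction: the new circular distance is `|u_μ − u′_μ|`
    have hNμ := N0_Pref_of_mir (ℓ := ℓ) (Mh := Mh) (k := k) (k' := k') (P := P) (m := m) hm
    have h1 := hu.2 μ hm
    have h2 := hu'.2 μ hm
    have hN1 : 1 ≤ N0 ℓ Mh k' (Pref ℓ k k' P mir m) μ := one_le_of_mem u.2 μ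
    have hcen : 2 * |(u.1 - u'.1) μ| ≤ (N0 ℓ Mh k' (Pref ℓ k k' P mir m) μ : ℤ) := by
      rw [hNμ, Pi.sub_apply]
      have : |u.1 μ - u'.1 μ| ≤ nMir ℓ Mh k' m μ := abs_le.2 ⟨by linarith [h1.1, h2.2], by linarith [h1.2, h2.1]⟩
      linarith
    rw [circAbs_of_centred hN1 hcen]
    exact_mod_cast circAbs_le_abs (one_le_N0 hMh hP μ) _
  · rw [N0_Pref_of_not_mir hk hm]

/-- ★★★ **THE REFLECTED FAMILY** — a `k′`-level family of the `…L0` lineage on the doubled torus (top big blocks `S_{k′}`, side vector `Pref`), with (2.1) and (2.2)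
PROVED from those of `F`: (2.1) by the grid compatibility of the fold and of the embedding, (2.2) by the 1-Lipschitz fold and `dist_{N₀} ≤ dist_{N′}` on the closed box.
[cite: Balaban1984PropagatorsII, (2.1)–(2.2) p.224, p.229 («effective mass … up to +∞ outside Ω₁»); Balaban1983RegularityDecay, (2.42) p.584] -/
def reflected (F : TDomains d ℓ Mh k P R) (k' : ℕ) (mir : Fin (d + 1) → Bool) (m : Fin (d + 1) → ℕ) (g : Fin (d + 1) → ℤ)
    (hL : Odd (ℓ + 1)) (hM : Odd Mh) (hMh : 1 ≤ Mh) (hP : ∀ μ, 1 ≤ P μ) (hk : k' ≤ k) (hlev : ∀ x, F.lev x ≤ k')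
    (hm : ∀ μ, mir μ = true → 2 ≤ m μ) (hg : ∀ μ, sTop ℓ Mh k' ∣ g μ) :
    TDomains d ℓ Mh k' (Pref ℓ k k' P mir m) R where
  lev := levR F k' mir m g (hmir_of_top hL hM hMh hm)
  lev_le y := by
    unfold levR
    split_ifs
    · exact hlev _
    · exact Nat.zero_le _
  bigBlocks J hJ y hy y' hy' hb := by
    rw [levR_of_mem hy, levR_of_mem hy']
    rcases Nat.lt_or_ge k' J with hJk | hJk
    · -- above the top level both sides are false
      constructor <;> intro h
      · exact absurd (h.trans (hlev _)) (not_le.2 hJk)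
      · exact absurd (h.trans (hlev _)) (not_le.2 hJk)
    · have hS : 0 < bigSide ℓ Mh J := one_le_bigSide hMh J
      -- same big `J`-block ⇒ same after the fold ⇒ same after the embedding ⇒ `F.bigBlocks`
      have h1 := blk_tfold_eq_of_blk_eq (hmir_of_top hL hM hMh hm) hS (hgrid_of_top hL hM hm hJk) (x := ⟨y', hy'⟩) (y := ⟨y, hy⟩) hb
      have hdvdS : ((bigSide ℓ Mh J : ℕ) : ℤ) ∣ sTop ℓ Mh k' := by
        unfold sTop bigSide
        exact_mod_cast mul_dvd_mul_left Mh (pow_dvd_pow _ (by omega))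
      have h2 := blk_emb_eq_of_blk_eq (ℓ := ℓ) (Mh := Mh) (k := k) (P := P) hMh hP hS
        (fun μ => hdvdS.trans (hg μ))
        (fun μ => by
          rw [N0_eq_bigSide_mul]; push_cast
          exact Dvd.dvd.mul_right (by exact_mod_cast mul_dvd_mul_left Mh (pow_dvd_pow _ (by omega))) _) h1
      exact (F.bigBlocks J hJ _ (emb_mem hMh hP g _) _ (emb_mem hMh hP g _) h2.symm).symm
  sepT J y hy y' hy' h1 h2 := by
    rw [levR_of_mem hy] at h1
    rw [levR_of_mem hy'] at h2
    have hsep := F.sepT J _ (emb_mem hMh hP g _) _ (emb_mem hMh hP g _) h1 h2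
    refine lt_of_lt_of_le hsep (le_trans ?_ (torusSupNorm_tfold_sub_le (hmir_of_top hL hM hMh hm) ⟨y, hy⟩ ⟨y', hy'⟩))
    exact torusSupNorm_emb_sub_le hMh hP hk (tfold_mem_closed _ _) (tfold_mem_closed _ _)

/-- the level function of the reflected family, unfolded. [cite: Balaban1984PropagatorsII, (2.3)–(2.4) p.224, dictionary] -/
theorem reflected_lev (F : TDomains d ℓ Mh k P R) (k' : ℕ) (mir : Fin (d + 1) → Bool) (m : Fin (d + 1) → ℕ) (g : Fin (d + 1) → ℤ)
    (hL : Odd (ℓ + 1)) (hM : Odd Mh) (hMh : 1 ≤ Mh) (hP : ∀ μ, 1 ≤ P μ) (hk : k' ≤ k) (hlev : ∀ x, F.lev x ≤ k')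
    (hm : ∀ μ, mir μ = true → 2 ≤ m μ) (hg : ∀ μ, sTop ℓ Mh k' ∣ g μ) :
    (reflected F k' mir m g hL hM hMh hP hk hlev hm hg).lev = levR F k' mir m g (hmir_of_top hL hM hMh hm) := rfl

/-- ★ **THE REFLECTED FAMILY AS AN INDEX OF THE CENSUS** (`k′ ≥ 1`, `m_μ ≥ 2` in the mirrored directions, `P_μ ≥ 4` in the others): p33's
`prop22_supEntries_kLevelTorus` applies to it by name. [cite: Balaban1984PropagatorsII, Prop. 2.2 (2.67) p.234, (2.1)–(2.2) p.224] -/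
def reflectedIdx (F : TDomains d ℓ Mh k P R) (k' : ℕ) (mir : Fin (d + 1) → Bool) (m : Fin (d + 1) → ℕ) (g : Fin (d + 1) → ℤ)
    (hL : Odd (ℓ + 1)) (hM : Odd Mh) (hMh : 1 ≤ Mh) (hP4 : ∀ μ, 4 ≤ P μ) (hk1 : 1 ≤ k') (hk : k' ≤ k) (hlev : ∀ x, F.lev x ≤ k')
    (hm : ∀ μ, mir μ = true → 2 ≤ m μ) (hg : ∀ μ, sTop ℓ Mh k' ∣ g μ) (hR : 2 * (ℓ + 1) ≤ R) : KTIdx d ℓ where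
  k := k'
  Mh := Mh
  R := R
  P := Pref ℓ k k' P mir m
  D := reflected F k' mir m g hL hM hMh (fun μ => le_trans (by norm_num) (hP4 μ)) hk hlev hm hg
  hk := hk1
  hMh := hMh
  hR := hR
  hP4 μ := by
    unfold Pref
    split_ifs with hμ
    · have := hm μ hμ; omega
    · exact le_trans (hP4 μ) (Nat.le_mul_of_pos_left _ (Nat.pow_pos (Nat.succ_pos ℓ)))

end Reflected

end

end Literature.MathematicalPhysics.QuantumFieldTheory.Balaban1983to89.B6MultiLevelTorusMirrorL0
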